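import Summits.QuantumFields.QCD.Theorems.EulerDescentHonestHeavyAnchorIntrinsicCornerAssembly

/-!
# The intrinsic Wilson corner of `EulerDescent.HonestHeavyAnchor` (stmt-QuantumFields-16901), stub
# `stub_intrinsicCorner`: NECESSITY of the two fixed-coupling halves — the stub is EXACTLY
# "massive barrier at weak coupling ∧ closing Wilson-axis transition"

Companion to `Theorems/EulerDescentHonestHeavyAnchorIntrinsicCornerAssembly.lean`, which proves the registered stub
`stub_intrinsicCorner` of `Cruxes/HonestHeavyAnchor/Lines/bounded_locator.lean` FROM two fixed-coupling statements
about lattice QCD — (B) for `N_f ∈ {2,3}` and every `ε > 0`, at all large `β` every degenerate bare Wilson mass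
`μ ≥ ε` is massive; (N) for every `ε > 0`, at all large `β` some `μ > −ε` is non-massive.  Here the converse:
the stub IMPLIES (B) and (N) (`weakCouplingHalves_of_intrinsicCorner`), hence
`intrinsicCorner_iff_weakCouplingHalves` — reshaping the stub into the two fixed-coupling stubs is an equivalent cut.

The one ingredient beyond order bookkeeping is a REALISABILITY lemma of independent use for turning statements
"for every asymptotically scaling regularisation …" into statements at fixed coupling:
`exists_regularisation_beta_eq` — for `N_f ≤ 16`, EVERY real sequence `b_k → +∞` is the coupling sequence
`reg.β` of some `QCDRegularisation N_f` whose schemes scale asymptotically (two-loop profile with `Λ = 1`): choose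
`a_k ∈ (0, ½]` with `afBeta N_f 1 a_k = b_k` by the intermediate value theorem (`afBeta N_f 1` is continuous on
every `[δ, ½]`, `δ > 0`, and `→ +∞` as `a → 0⁺`, `tendsto_afBeta_atTop`), so that `β_k − afBeta N_f 1 a_k = 0`
eventually; `a_k → 0` because `afBeta` is bounded on each `[δ, ½]`; `L_k := ⌈k/a_k⌉₊`.  Hence a bad coupling
sequence violating (B) or (N) would be the coupling sequence of an asymptotically scaling regularisation, along which
the stub's corner `mc k → 0` forces the windows of `windows_of_corner` — contradiction.

No `def`, no `sorry`; axioms standard.  Sources as in the companion file (MontvayMunster1994 §3.3.3 (3.263)–(3.265)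
for the two-loop profile; §5.1 for `K_cr`).
-/

namespace Summit.QuantumFields.QCD.Theorems.HonestHeavyAnchorIntrinsicCornerRealisation

open Filter Topology
open Literature.MathematicalPhysics.QuantumFieldTheory
open Summit.QuantumFields.QCD.Theorems.HonestHeavyAnchorIntrinsicCorner

/-! ## §1 Realising a divergent coupling sequence by an asymptotically scaling regularisation -/

/-- The two-loop profile `a ↦ afBeta N_f 1 a` is continuous on every compact interval `[δ, a₀] ⊂ (0, 1)`
(there `1/a² > 1`, so both logarithms are taken at points where `Real.log` is continuous and the inner one is
positive). [folklore] -/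
theorem continuousOn_afBeta_one (Nf : ℕ) {δ a₀ : ℝ} (hδ : 0 < δ) (ha₀ : a₀ < 1) :
    ContinuousOn (fun a : ℝ => afBeta Nf 1 a) (Set.Icc δ a₀) := by
  have hpos : ∀ a ∈ Set.Icc δ a₀, 0 < a := fun a ha => hδ.trans_le ha.1
  have hgt : ∀ a ∈ Set.Icc δ a₀, 1 < 1 / (a ^ 2 * 1 ^ 2) := by
    intro a ha
    have ha0 : 0 < a := hpos a ha
    have ha1 : a < 1 := ha.2.trans_lt ha₀
    have hsq : a ^ 2 * 1 ^ 2 < 1 := by nlinarith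
    rw [lt_div_iff₀ (by positivity), one_mul]
    exact hsq
  have hinner : ContinuousOn (fun a : ℝ => 1 / (a ^ 2 * 1 ^ 2)) (Set.Icc δ a₀) := by
    refine ContinuousOn.div continuousOn_const (by fun_prop) fun a ha => ?_
    have := hpos a ha
    positivity
  have hlog : ContinuousOn (fun a : ℝ => Real.log (1 / (a ^ 2 * 1 ^ 2))) (Set.Icc δ a₀) :=
    hinner.log fun a ha => (zero_lt_one.trans (hgt a ha)).ne'
  have hloglog : ContinuousOn (fun a : ℝ => Real.log (Real.log (1 / (a ^ 2 * 1 ^ 2)))) (Set.Icc δ a₀) :=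
    hlog.log fun a ha => (Real.log_pos (hgt a ha)).ne'
  unfold afBeta
  exact ((continuousOn_const.mul hlog).add (continuousOn_const.mul hloglog))

/-- **Intermediate values of the two-loop profile**: for `N_f ≤ 16`, `0 < a₀ < 1` and every level
`y ≥ afBeta N_f 1 a₀` there is `a ∈ (0, a₀]` with `afBeta N_f 1 a = y` (the profile is continuous on `(0, a₀]`
and diverges to `+∞` at `0⁺`). [folklore] -/
theorem exists_afBeta_one_eq {Nf : ℕ} (hNf : Nf ≤ 16) {a₀ : ℝ} (ha₀ : 0 < a₀) (ha₀' : a₀ < 1) {y : ℝ}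
    (hy : afBeta Nf 1 a₀ ≤ y) : ∃ a ∈ Set.Ioc 0 a₀, afBeta Nf 1 a = y := by
  -- a small point `a' = a₀/(n+1)` where the profile already exceeds `y`
  have hseq_pos : ∀ n : ℕ, 0 < a₀ * (1 / ((n : ℝ) + 1)) := fun n => by positivity
  have hseq0 : Tendsto (fun n : ℕ => a₀ * (1 / ((n : ℝ) + 1))) atTop (𝓝 0) := by
    simpa using (tendsto_one_div_add_atTop_nhds_zero_nat (𝕜 := ℝ)).const_mul a₀
  have ht := tendsto_afBeta_atTop hNf one_pos hseq_pos hseq0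
  obtain ⟨n, hn⟩ := (ht.eventually_ge_atTop y).exists
  have ha'le : a₀ * (1 / ((n : ℝ) + 1)) ≤ a₀ := by
    have h1 : 1 / ((n : ℝ) + 1) ≤ 1 := by
      rw [div_le_one (by positivity)]
      linarith [(n.cast_nonneg : (0 : ℝ) ≤ n)]
    simpa using mul_le_mul_of_nonneg_left h1 ha₀.le
  have hcont := continuousOn_afBeta_one Nf (hseq_pos n) ha₀'
  obtain ⟨a, ha, hfa⟩ := intermediate_value_Icc' ha'le hcont ⟨hy, hn⟩
  exact ⟨a, ⟨(hseq_pos n).trans_le ha.1, ha.2⟩, hfa⟩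

/-- **Every divergent coupling sequence is realised by an asymptotically scaling regularisation** (`N_f ≤ 16`):
for every real sequence `b_k → +∞` there is a `QCDRegularisation N_f` with `reg.β = b` (exactly) whose degenerate
scheme scales asymptotically (`β_k − afBeta N_f 1 a_k = 0` eventually, `a_k → 0`, `a_k L_k → ∞`).  This is the
lemma that converts statements quantified over all asymptotically scaling regularisations but reading only `reg.β`
into statements at fixed (large) coupling. [folklore] -/
theorem exists_regularisation_beta_eq {Nf : ℕ} (hNf : Nf ≤ 16) (b : ℕ → ℝ) (hb : Tendsto b atTop atTop) :
    ∃ reg : QCDRegularisation Nf, reg.β = b ∧ (reg.scheme 0 0 0).HasAsymptoticScaling := by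
  have hhalf : (0 : ℝ) < 1 / 2 := by norm_num
  have hhalf' : (1 : ℝ) / 2 < 1 := by norm_num
  have hex : ∀ k : ℕ, ∃ a : ℝ, a ∈ Set.Ioc (0 : ℝ) (1 / 2) ∧
      (afBeta Nf 1 (1 / 2) ≤ b k → afBeta Nf 1 a = b k) := by
    intro k
    by_cases hk : afBeta Nf 1 (1 / 2) ≤ b k
    · obtain ⟨a, ha, hfa⟩ := exists_afBeta_one_eq hNf hhalf hhalf' hk
      exact ⟨a, ha, fun _ => hfa⟩
    · exact ⟨1 / 2, ⟨hhalf, le_rfl⟩, fun h => absurd h hk⟩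
  choose a ha hfa using hex
  have ha_pos : ∀ k, 0 < a k := fun k => (ha k).1
  have hev : ∀ᶠ k in atTop, afBeta Nf 1 (a k) = b k :=
    (hb.eventually_ge_atTop _).mono fun k hk => hfa k hk
  -- `a_k → 0`: the profile is bounded on `[δ, ½]`, while `afBeta (a k) = b k → ∞`
  have ha0 : Tendsto a atTop (𝓝 0) := by
    refine tendsto_order.2 ⟨fun δ hδ => Eventually.of_forall fun k => hδ.trans (ha_pos k), fun δ hδ => ?_⟩
    by_cases hδ' : (1 : ℝ) / 2 < δ
    · exact Eventually.of_forall fun k => (ha k).2.trans_lt hδ'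
    · push Not at hδ'
      obtain ⟨M, hM⟩ := isCompact_Icc.bddAbove_image (continuousOn_afBeta_one Nf hδ hhalf')
      filter_upwards [hev, hb.eventually_gt_atTop M] with k hk hkM
      by_contra hcon
      push Not at hcon
      have hmem : afBeta Nf 1 (a k) ∈ (fun a : ℝ => afBeta Nf 1 a) '' Set.Icc δ (1 / 2) :=
        ⟨a k, ⟨hcon, (ha k).2⟩, rfl⟩
      have hle : afBeta Nf 1 (a k) ≤ M := hM hmem
      linarith
  refine ⟨
    { a := a, a_pos := ha_pos, tendsto_a := ha0, β := b, L := fun k => ⌈(k : ℝ) / a k⌉₊,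
      tendsto_L := ?_, mcrit := fun _ => 0, Zm := fun _ => 1, Zm_pos := fun _ => one_pos }, rfl, ?_⟩
  · refine tendsto_atTop_mono (fun k => ?_) tendsto_natCast_atTop_atTop
    have hak : a k ≠ 0 := (ha_pos k).ne'
    have h1 : (k : ℝ) / a k ≤ (⌈(k : ℝ) / a k⌉₊ : ℝ) := Nat.le_ceil _
    calc (k : ℝ) = a k * ((k : ℝ) / a k) := by field_simp
      _ ≤ a k * (⌈(k : ℝ) / a k⌉₊ : ℝ) := mul_le_mul_of_nonneg_left h1 (ha_pos k).le
  · refine ⟨1, one_pos, tendsto_const_nhds.congr' ?_⟩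
    filter_upwards [hev] with k hk
    show (0 : ℝ) = b k - afBeta Nf 1 (a k)
    rw [hk, sub_self]

/-! ## §2 Necessity of the two fixed-coupling windows (generic in the massiveness predicate) -/

/-- **Fixed-coupling windows from the sequential corner law** (generic in a predicate `P β μ`, "massive at
`(β, μ)`"; `N_f ≤ 16`).  If along EVERY asymptotically scaling regularisation the set `{μ | ¬ P (β_k) μ}` eventually
has a least upper bound `mc k` with `mc k → 0`, then (B) for every `ε > 0`, at all large `β` every `μ ≥ ε`
satisfies `P β μ`, and (N) for every `ε > 0`, at all large `β` some `μ > −ε` fails `P β μ`.  Proof: a bad coupling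
sequence `b_k ≥ k` is realised by `exists_regularisation_beta_eq`, and `windows_of_corner` along it contradicts
badness. [folklore] -/
theorem fixedCoupling_windows_of_sequential_corner {Nf : ℕ} (hNf : Nf ≤ 16) (P : ℝ → ℝ → Prop)
    (h : ∀ reg : QCDRegularisation Nf, (reg.scheme 0 0 0).HasAsymptoticScaling →
      ∃ mc : ℕ → ℝ, (∀ᶠ k in atTop, IsLUB {μ : ℝ | ¬ P (reg.β k) μ} (mc k)) ∧ Tendsto mc atTop (𝓝 0)) :
    (∀ ε : ℝ, 0 < ε → ∃ β₀ : ℝ, ∀ β : ℝ, β₀ ≤ β → ∀ μ : ℝ, ε ≤ μ → P β μ) ∧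
      (∀ ε : ℝ, 0 < ε → ∃ β₀ : ℝ, ∀ β : ℝ, β₀ ≤ β → ∃ μ : ℝ, -ε < μ ∧ ¬ P β μ) := by
  constructor
  · intro ε hε
    by_contra hcon
    push Not at hcon
    choose f hf g hg hng using hcon
    have hb : Tendsto (fun k : ℕ => f k) atTop atTop :=
      tendsto_atTop_mono (fun k => hf k) tendsto_natCast_atTop_atTop
    obtain ⟨reg, hβ, haf⟩ := exists_regularisation_beta_eq hNf (fun k : ℕ => f k) hb
    obtain ⟨mc, hc, h0⟩ := h reg haf
    obtain ⟨-, hbw⟩ := windows_of_corner _ mc hc h0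
    obtain ⟨k, hk⟩ := (hbw ε hε).exists
    have hk' := hk (g k) (hg k)
    rw [hβ] at hk'
    exact hk' (hng k)
  · intro ε hε
    by_contra hcon
    push Not at hcon
    choose f hf hP using hcon
    have hb : Tendsto (fun k : ℕ => f k) atTop atTop :=
      tendsto_atTop_mono (fun k => hf k) tendsto_natCast_atTop_atTop
    obtain ⟨reg, hβ, haf⟩ := exists_regularisation_beta_eq hNf (fun k : ℕ => f k) hb
    obtain ⟨mc, hc, h0⟩ := h reg haf
    obtain ⟨hnw, -⟩ := windows_of_corner _ mc hc h0
    obtain ⟨k, μ, hμ, hεμ⟩ := (hnw ε hε).exists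
    rw [hβ] at hμ
    exact hμ (hP k μ hεμ)

/-! ## §3 The stub is exactly the conjunction of the two fixed-coupling halves -/

/-- **Necessity**: the registered stub `stub_intrinsicCorner` (hypothesis, verbatim) implies BOTH fixed-coupling
halves — (B) the massive barrier at weak coupling and (N) the closing Wilson-axis transition (conclusion: the two
hypotheses of `intrinsicCorner_of_weakCouplingBarrier_of_closingTransition`, verbatim). [folklore] -/
theorem weakCouplingHalves_of_intrinsicCorner :
    (∀ Nf : ℕ, Nf = 2 ∨ Nf = 3 → ∀ reg : QCDRegularisation Nf, (reg.scheme 0 0 0).HasAsymptoticScaling →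
      ∃ mc : ℕ → ℝ, (∀ᶠ k in atTop, IsLUB {μ : ℝ | ¬ (∀ (R R' : ℕ) (A : QCDLatticeObservable Nf R)
        (B : QCDLatticeObservable Nf R'), ∃ (C δ : ℝ) (S₀ : ℕ), 0 < δ ∧ ∀ S : ℕ, S₀ ≤ S → ∀ n : ℕ, n ≤ S →
          ‖qcdLatticeConnectedCorr (reg.β k) (2 * S + 1) (fun _ : Fin Nf => μ) A B n‖ ≤ C * Real.exp (-(δ * n)))} (mc k)) ∧
        Tendsto mc atTop (𝓝 0)) →
    (∀ Nf : ℕ, Nf = 2 ∨ Nf = 3 → ∀ ε : ℝ, 0 < ε → ∃ β₀ : ℝ, ∀ β : ℝ, β₀ ≤ β → ∀ μ : ℝ, ε ≤ μ →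
      ∀ (R R' : ℕ) (A : QCDLatticeObservable Nf R) (B : QCDLatticeObservable Nf R'),
        ∃ (C δ : ℝ) (S₀ : ℕ), 0 < δ ∧ ∀ S : ℕ, S₀ ≤ S → ∀ n : ℕ, n ≤ S →
          ‖qcdLatticeConnectedCorr β (2 * S + 1) (fun _ : Fin Nf => μ) A B n‖ ≤ C * Real.exp (-(δ * n))) ∧
    (∀ Nf : ℕ, Nf = 2 ∨ Nf = 3 → ∀ ε : ℝ, 0 < ε → ∃ β₀ : ℝ, ∀ β : ℝ, β₀ ≤ β → ∃ μ : ℝ, -ε < μ ∧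
      ¬ (∀ (R R' : ℕ) (A : QCDLatticeObservable Nf R) (B : QCDLatticeObservable Nf R'),
        ∃ (C δ : ℝ) (S₀ : ℕ), 0 < δ ∧ ∀ S : ℕ, S₀ ≤ S → ∀ n : ℕ, n ≤ S →
          ‖qcdLatticeConnectedCorr β (2 * S + 1) (fun _ : Fin Nf => μ) A B n‖ ≤ C * Real.exp (-(δ * n)))) := by
  intro h
  have key := fun (Nf : ℕ) (hNf : Nf = 2 ∨ Nf = 3) =>
    fixedCoupling_windows_of_sequential_corner (Nf := Nf) (by rcases hNf with rfl | rfl <;> norm_num)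
      (fun β μ => ∀ (R R' : ℕ) (A : QCDLatticeObservable Nf R) (B : QCDLatticeObservable Nf R'),
        ∃ (C δ : ℝ) (S₀ : ℕ), 0 < δ ∧ ∀ S : ℕ, S₀ ≤ S → ∀ n : ℕ, n ≤ S →
          ‖qcdLatticeConnectedCorr β (2 * S + 1) (fun _ : Fin Nf => μ) A B n‖ ≤ C * Real.exp (-(δ * n)))
      (h Nf hNf)
  exact ⟨fun Nf hNf => (key Nf hNf).1, fun Nf hNf => (key Nf hNf).2⟩

/-- **The stub is EXACTLY the two fixed-coupling halves**: `stub_intrinsicCorner` (verbatim) holds if and only if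
(B) the massive barrier at weak coupling and (N) the closing Wilson-axis transition both hold
(`intrinsicCorner_of_weakCouplingBarrier_of_closingTransition` and `weakCouplingHalves_of_intrinsicCorner`).
[folklore] -/
theorem intrinsicCorner_iff_weakCouplingHalves :
    (∀ Nf : ℕ, Nf = 2 ∨ Nf = 3 → ∀ reg : QCDRegularisation Nf, (reg.scheme 0 0 0).HasAsymptoticScaling →
      ∃ mc : ℕ → ℝ, (∀ᶠ k in atTop, IsLUB {μ : ℝ | ¬ (∀ (R R' : ℕ) (A : QCDLatticeObservable Nf R)
        (B : QCDLatticeObservable Nf R'), ∃ (C δ : ℝ) (S₀ : ℕ), 0 < δ ∧ ∀ S : ℕ, S₀ ≤ S → ∀ n : ℕ, n ≤ S →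
          ‖qcdLatticeConnectedCorr (reg.β k) (2 * S + 1) (fun _ : Fin Nf => μ) A B n‖ ≤ C * Real.exp (-(δ * n)))} (mc k)) ∧
        Tendsto mc atTop (𝓝 0)) ↔
    ((∀ Nf : ℕ, Nf = 2 ∨ Nf = 3 → ∀ ε : ℝ, 0 < ε → ∃ β₀ : ℝ, ∀ β : ℝ, β₀ ≤ β → ∀ μ : ℝ, ε ≤ μ →
      ∀ (R R' : ℕ) (A : QCDLatticeObservable Nf R) (B : QCDLatticeObservable Nf R'),
        ∃ (C δ : ℝ) (S₀ : ℕ), 0 < δ ∧ ∀ S : ℕ, S₀ ≤ S → ∀ n : ℕ, n ≤ S →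
          ‖qcdLatticeConnectedCorr β (2 * S + 1) (fun _ : Fin Nf => μ) A B n‖ ≤ C * Real.exp (-(δ * n))) ∧
    (∀ Nf : ℕ, Nf = 2 ∨ Nf = 3 → ∀ ε : ℝ, 0 < ε → ∃ β₀ : ℝ, ∀ β : ℝ, β₀ ≤ β → ∃ μ : ℝ, -ε < μ ∧
      ¬ (∀ (R R' : ℕ) (A : QCDLatticeObservable Nf R) (B : QCDLatticeObservable Nf R'),
        ∃ (C δ : ℝ) (S₀ : ℕ), 0 < δ ∧ ∀ S : ℕ, S₀ ≤ S → ∀ n : ℕ, n ≤ S →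
          ‖qcdLatticeConnectedCorr β (2 * S + 1) (fun _ : Fin Nf => μ) A B n‖ ≤ C * Real.exp (-(δ * n))))) :=
  ⟨weakCouplingHalves_of_intrinsicCorner,
    fun h => intrinsicCorner_of_weakCouplingBarrier_of_closingTransition h.1 h.2⟩

end Summit.QuantumFields.QCD.Theorems.HonestHeavyAnchorIntrinsicCornerRealisation
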